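import Summits.BirchSwinnertonDyer.BirchSwinnertonDyer.Theorems.PrintCf2SplitBadTwoUpperBaseLiftSelmer
import Summits.BirchSwinnertonDyer.BirchSwinnertonDyer.Theorems.PrintCf2SplitBadTwoH1ColimClosedSubgroup
import Summits.BirchSwinnertonDyer.BirchSwinnertonDyer.Theorems.PrintCf2SplitBadTwoLineDoubleCosetPlacesMirror
import Summits.BirchSwinnertonDyer.BirchSwinnertonDyer.Theorems.PrintCf2SplitBadTwoLineDoubleCosetLayers
import Literature.NumberTheory.EllipticCurves.Kato2004.IwasawaH1ReductionInfty
import HarnessLib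

/-!
# Crux `PrintCf2.SplitBadTwoRankOneOfFacts` (stmt-BirchSwinnertonDyer-20368), skeleton v13.1, stub S3n′ `stub_pseudoNullFinite_two`,
# S3N-FACTFREE brick R3b: THE LIMIT STEP — local surjectivity at the LAYERS `K_n = K̄^{κ.layerSubgroup n}` (`n ≫ 0`) ⟹ (LS↑) over `K_∞ = K̄^{ker κ}`

Cell `bsd-print-cf2`, EXTRA WIDTH seat `bsd-line-cf2-p1-w4` g12 (prover-bsd-line-cf2-p1-w4-g12-0); `--supports stmt-BirchSwinnertonDyer-20368`
(helper, Theses-free). HONEST FRAMING: nothing here closes the crux or a registered stub; BSD is not proved by any of this; no summit statement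
is proved by this seat. No definition, no named fact, no `sorry`. CONDITIONAL on the displayed hypothesis (LSₙ) below (for all `n ≥ n₁`).

WHAT. The one-level-up base lift (p698230 `baseLift_unr₂_of_locSurj`, with (hul↑) discharged in p699029) reduces (B) of p684477 and (REG) to
 (LS↑) the Greenberg–Vatsal surjectivity over the LINE `K*_∞ = K̄^{ker κ₂}`: targets at the places of `K*_∞` above a finite set `T` of places of
       `K` (double cosets `D_w \ Γ_K / ker κ₂`, representatives `q.out`), matched modulo classes vanishing on `ker κ₂ ∩ I_w`, unramified elsewhere.
THIS FILE proves (LS↑) for ANY `ℤ_p`-extension `κ` (in the application `κ = κ₂`) from the same statements at the finite LAYERS,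
 (LSₙ) := (LS↑) with `ker κ` replaced by the open subgroup `κ.layerSubgroup n = Gal(K̄/K_n)` (targets in `H¹(Γ_n ∩ D_w, M)` at the places of the
        NUMBER FIELD `K_n` above `w ∈ T` = double cosets `D_w \ Γ_K / Γ_n`, a class `z' ∈ H¹(K_n, M) = H¹(Γ_n, M)`), for all `n ≥ n₁`,
granted that no place `w ∤ p` and not `v̄` splits completely in `K_∞` (`¬ D_w ≤ ker κ`; on road α: (C1) off `v̄`, `not_decomp_le_kerSubgroup_of_
isImaginaryQuadratic` at `v̄`). Mechanism (GV 2000 Prop. 2.1's passage to the limit, made elementary): (1) each target `τ w q ∈ H¹(ker κ ∩ D_w, M)` is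
RESTRICTED FROM SOME LAYER — `H1Colim.exists_resOfLe_eq_of_forall_mem` (p699360) in the profinite group `D_w` with `⋂ₙ (Γ_n ∩ D_w) = ker κ ∩ D_w`;
(2) finitely many places of `K_∞` above each `w` (-w8 g4 `LineDoubleCoset.finite_doubleCosetQuotient_decomp_of_not_le'`) ⟹ a COMMON layer `N ≥ n₁`,
also `≥` the stabilisation level of -w8 g4's `doubleCoset_mk_layerSubgroup_eq_iff_mk_kerSubgroup_eq` (the places of `K_N` and of `K_∞` above `w ∈ T`
have the same index set); (3) (LS_N) with the lifted targets transported to the `K_N`-representatives `Q.out = d · q.out · g` (`d ∈ D_w`, `g ∈ ker κ`)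
by `conj_d` inside `D_w`; (4) restrict the class `z'` from `Γ_N` to `ker κ` — `conj_g` acts trivially on `H¹(Γ_N, M)`, `conj_{d⁻¹} conj_d = 1`,
restriction commutes with localisation and preserves «vanishing on inertia» / «unramified».
* §1 `resH1Hom_decompInToH_comp_resOfLe`, `resH1Hom_inertiaInToH_comp_resOfLe`, `resOfLe_conjH1_decompIn_eq_zero` — bookkeeping for `S ≤ H`;
* §2 `exists_forall_le_exists_resOfLe_decompIn_layerSubgroup_eq` — every class of `H¹(ker κ ∩ D_w, M)` is restricted from `H¹(Γ_n ∩ D_w, M)`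
  for all `n ≫ 0`;
* §3 **`locSurj_of_layers`** — (LSₙ) for all `n ≥ n₁` ∧ «no relevant place splits completely in `K_∞`» ⟹ (LS↑) VERBATIM (the hypothesis `hLS` of
  p698230 / p699029, with `κ₂ := κ`).
presearch: GV 2000 §2 Prop. 2.1 (pp. 17–21, limit over `ℚ_n`); Greenberg LNM 1716 §4 Props. 4.13–4.15; Serre I §2.2 Prop. 8; held. No new fact.
beyond-print theorem: no.

References: [GreenbergVatsal2000] §2 Prop. 2.1; [GreenbergLNM1716] §4 Props. 4.13–4.15; [SerreGaloisCohomology1997] I §2.2 Prop. 8, I §2.5;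
[Washington1997] §13.1–13.2.
-/

noncomputable section

open scoped Classical

set_option linter.dupNamespace false
set_option autoImplicit false

open NumberField IsDedekindDomain Field
open Literature.NumberTheory.EllipticCurves Literature.NumberTheory.EllipticCurves.GreenbergSelmer
open Literature.NumberTheory.EllipticCurves.GreenbergVatsal2000
open Literature.NumberTheory.GaloisRepresentations
open Summit.BirchSwinnertonDyer.Rank1Residual.X11b

namespace Summit.BirchSwinnertonDyer.BirchSwinnertonDyer.Theorems.PrintCf2.UpperBaseLift

/-! ## §1. Bookkeeping for a pair of subgroups `S ≤ H` of `Γ_K` at a place `w` -/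

section Pair

variable {K : Type} [Field K] [NumberField K] {S H : Subgroup (absoluteGaloisGroup K)}
  (M : Type) [AddCommGroup M] [DistribMulAction (absoluteGaloisGroup K) M] [TopologicalSpace M] [DiscreteTopology M]
  (w : HeightOneSpectrum (𝓞 K))

/-- **Restriction `H¹(H, M) → H¹(S, M)` commutes with localisation at the decomposition groups** (`S ≤ H`): both composites are the restriction
`H¹(H, M) → H¹(S ∩ D_w, M)`. [cite: SerreGaloisCohomology1997, I §2.5] -/
theorem resH1Hom_decompInToH_comp_resOfLe (hSH : S ≤ H) :
    (resH1Hom (decompInToH S w) (AddMonoidHom.id M) (fun _ _ ↦ rfl)).comp (resOfLe M hSH) =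
      (resOfLe M (AcSelmer.decompIn_mono hSH w)).comp (resH1Hom (decompInToH H w) (AddMonoidHom.id M) (fun _ _ ↦ rfl)) := by
  rw [Literature.NumberTheory.EllipticCurves.resOfLe, Literature.NumberTheory.EllipticCurves.resOfLe, resH1Hom_comp, resH1Hom_comp]
  exact resH1Hom_congr (ContinuousMonoidHom.ext fun _ ↦ rfl) (AddMonoidHom.ext fun _ ↦ rfl) _ _

/-- The same square for the inertia groups: both composites are the restriction `H¹(H, M) → H¹(S ∩ I_w, M)`. [cite: SerreGaloisCohomology1997, I §2.5] -/
theorem resH1Hom_inertiaInToH_comp_resOfLe (hSH : S ≤ H) (hI : inertiaIn S w ≤ inertiaIn H w) :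
    (resH1Hom (inertiaInToH S w) (AddMonoidHom.id M) (fun _ _ ↦ rfl)).comp (resOfLe M hSH) =
      (resOfLe M hI).comp (resH1Hom (inertiaInToH H w) (AddMonoidHom.id M) (fun _ _ ↦ rfl)) := by
  rw [Literature.NumberTheory.EllipticCurves.resOfLe, Literature.NumberTheory.EllipticCurves.resOfLe, resH1Hom_comp, resH1Hom_comp]
  exact resH1Hom_congr (ContinuousMonoidHom.ext fun _ ↦ rfl) (AddMonoidHom.ext fun _ ↦ rfl) _ _

variable {M w} in
/-- **`conj_d` (`d ∈ D_w`, computed inside `D_w`) preserves the classes of `H¹(H ∩ D_w, M)` vanishing on `H ∩ I_w`** (restriction to the normal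
subgroup `H ∩ I_w ⊴ D_w` intertwines the two conjugations). [cite: NeukirchSchmidtWingberg2008, I.§5] -/
theorem resOfLe_conjH1_decompIn_eq_zero [H.Normal] [(decompIn H w).Normal] (d : decomp (K := K) w) {x : subgroupH1 (decompIn H w) M}
    (hx : resOfLe M (inertiaIn_le_decompIn H w) x = 0) :
    resOfLe M (inertiaIn_le_decompIn H w) (conjH1 (decompIn H w) M d x) = 0 := by
  haveI : (inertiaIn H w).Normal := SignedEC.SharpEigen.inertiaIn_normal H w
  rw [← AddMonoidHom.comp_apply, resOfLe_comp_conjH1_holds, AddMonoidHom.comp_apply, hx, map_zero]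

end Pair

/-! ## §2. Targets over `K_∞` are born at a finite layer -/

section Layer

variable {K : Type} [Field K] [NumberField K] {p : ℕ} [Fact p.Prime] (κ : ZpExtension K p)
  (M : Type) [AddCommGroup M] [DistribMulAction (absoluteGaloisGroup K) M] [TopologicalSpace M] [DiscreteTopology M]
  (w : HeightOneSpectrum (𝓞 K))

/-- `ker κ ∩ D_w ≤ Γ_n ∩ D_w` inside `D_w`. [cite: Washington1997, §13.1] -/
theorem decompIn_kerSubgroup_le_layerSubgroup (n : ℕ) : decompIn κ.kerSubgroup w ≤ decompIn (κ.layerSubgroup n) w :=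
  AcSelmer.decompIn_mono (κ.kerSubgroup_le_layerSubgroup n) w

/-- `ker κ ∩ I_w ≤ Γ_n ∩ I_w` inside `D_w`. [cite: Washington1997, §13.1] -/
theorem inertiaIn_kerSubgroup_le_layerSubgroup (n : ℕ) : inertiaIn κ.kerSubgroup w ≤ inertiaIn (κ.layerSubgroup n) w := fun y hy ↦
  (mem_inertiaIn_iff _ w y).2 ⟨κ.kerSubgroup_le_layerSubgroup n ((mem_inertiaIn_iff _ w y).1 hy).1, ((mem_inertiaIn_iff _ w y).1 hy).2⟩

variable {M w} in
/-- **Every class of `H¹(ker κ ∩ D_w, M) = H¹(K_{∞,η}, M)` is restricted from `H¹(Γ_n ∩ D_w, M) = H¹(K_{n,η_n}, M)` for all `n ≫ 0`**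
(`M` with open stabilisers): the colimit lemma `H1Colim.exists_resOfLe_eq_of_forall_mem` in the profinite group `D_w` for the closed subgroups
`Γ_n ∩ D_w` decreasing to `ker κ ∩ D_w` (`⋂ₙ Γ_n = ker κ`, Krull), then restriction down the layers. [cite: SerreGaloisCohomology1997, I §2.2 Prop. 8]
[cite: Washington1997, §13.1] -/
theorem exists_forall_le_exists_resOfLe_decompIn_layerSubgroup_eq
    (hstab : ∀ m : M, IsOpen (MulAction.stabilizer (absoluteGaloisGroup K) m : Set (absoluteGaloisGroup K)))
    (x : subgroupH1 (decompIn κ.kerSubgroup w) M) :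
    ∃ m : ℕ, ∀ n : ℕ, m ≤ n → ∃ x' : subgroupH1 (decompIn (κ.layerSubgroup n) w) M,
      resOfLe M (decompIn_kerSubgroup_le_layerSubgroup κ w n) x' = x := by
  haveI : CompactSpace (absoluteGaloisGroup K) := absoluteGaloisGroup_compactSpace K
  haveI : CompactSpace (decomp (K := K) w) := isCompact_iff_compactSpace.mp (Coinv.isClosed_decomp w).isCompact
  have hA : ∀ m : M, IsOpen {d : decomp (K := K) w | d • m = m} := fun m ↦ (hstab m).preimage continuous_subtype_val
  have hcl : ∀ (H : Subgroup (absoluteGaloisGroup K)), IsClosed (H : Set (absoluteGaloisGroup K)) →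
      IsClosed ((decompIn H w : Subgroup (decomp (K := K) w)) : Set (decomp (K := K) w)) := by
    intro H hH
    have e : ((decompIn H w : Subgroup (decomp (K := K) w)) : Set (decomp (K := K) w)) =
        Subtype.val ⁻¹' (H : Set (absoluteGaloisGroup K)) := by
      ext d
      exact mem_decompIn_iff H w d
    rw [e]
    exact hH.preimage continuous_subtype_val
  obtain ⟨m, x', hx'⟩ := H1Colim.exists_resOfLe_eq_of_forall_mem (ι := ℕ) hA (decompIn κ.kerSubgroup w)
    (hcl _ κ.isClosed_kerSubgroup) (fun n ↦ decompIn (κ.layerSubgroup n) w)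
    (fun n ↦ hcl _ ((κ.layerSubgroup n).isClosed_of_isOpen (κ.isOpen_layerSubgroup n)))
    (fun n ↦ decompIn_kerSubgroup_le_layerSubgroup κ w n)
    (fun i j ↦ ⟨max i j, AcSelmer.decompIn_mono (κ.layerSubgroup_antitone (le_max_left i j)) w,
      AcSelmer.decompIn_mono (κ.layerSubgroup_antitone (le_max_right i j)) w⟩)
    (fun g hg ↦ (mem_decompIn_iff _ w g).2
      (ZpExtension.mem_kerSubgroup_of_forall_mem_layerSubgroup κ fun n ↦ (mem_decompIn_iff _ w g).1 (hg n))) x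
  refine ⟨m, fun n hn ↦ ⟨resOfLe M (AcSelmer.decompIn_mono (κ.layerSubgroup_antitone hn) w) x', ?_⟩⟩
  rw [← AddMonoidHom.comp_apply, resOfLe_comp_holds]
  exact hx'

end Layer

/-! ## §3. (LSₙ) for `n ≫ 0` ⟹ (LS↑) -/

section Limit

variable {K : Type} [Field K] [NumberField K] {p : ℕ} [Fact p.Prime] (κ : ZpExtension K p)
  (M : Type) [AddCommGroup M] [DistribMulAction (absoluteGaloisGroup K) M] [TopologicalSpace M] [DiscreteTopology M]
  {vbar : HeightOneSpectrum (𝓞 K)}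

/-- **THE LIMIT STEP: local surjectivity at the layers `K_n`, `n ≥ n₁`, implies the local surjectivity (LS↑) over `K_∞`** — the hypothesis
`hLS` of p698230 `baseLift_unr₂_of_locSurj` / p699029 `X_regular_of_subsingleton_H2_of_locSurj_of_isTopGeneratorPair` VERBATIM (with `κ₂ := κ`),
GRANTED (LSₙ) for all `n ≥ n₁` (same statement with `ker κ ↦ Γ_n = κ.layerSubgroup n`: Greenberg–Vatsal's surjectivity `P_Σ` for the NUMBER FIELD
`K_n`) and that no place `w ∤ p`, nor `v̄`, splits completely in `K_∞` (`¬ D_w ≤ ker κ`). Module docstring, steps (1)–(4).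
[cite: GreenbergVatsal2000, §2 Prop. 2.1 (pp. 17–21)] [cite: GreenbergLNM1716, §4 Props. 4.13–4.15] [cite: SerreGaloisCohomology1997, I §2.2 Prop. 8] -/
theorem locSurj_of_layers
    (hstab : ∀ m : M, IsOpen (MulAction.stabilizer (absoluteGaloisGroup K) m : Set (absoluteGaloisGroup K)))
    (hD : ∀ w : HeightOneSpectrum (𝓞 K), (((p : ℕ) : 𝓞 K) ∉ w.asIdeal ∨ w = vbar) → ¬ decomp (K := K) w ≤ κ.kerSubgroup) (n₁ : ℕ)
    (hLSn : ∀ n : ℕ, n₁ ≤ n → ∀ (T : Finset (HeightOneSpectrum (𝓞 K))), (∀ w ∈ T, ((p : ℕ) : 𝓞 K) ∉ w.asIdeal ∨ w = vbar) →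
      ∀ τ' : (w : HeightOneSpectrum (𝓞 K)) →
        DoubleCoset.Quotient (decomp (K := K) w : Set (absoluteGaloisGroup K)) (κ.layerSubgroup n : Set (absoluteGaloisGroup K)) →
          subgroupH1 (decompIn (κ.layerSubgroup n) w) M,
      ∃ z' : subgroupH1 (κ.layerSubgroup n) M,
        (∀ w ∈ T, ∀ Q : DoubleCoset.Quotient (decomp (K := K) w : Set (absoluteGaloisGroup K)) (κ.layerSubgroup n : Set (absoluteGaloisGroup K)),
          resOfLe M (inertiaIn_le_decompIn (κ.layerSubgroup n) w)
            (resH1Hom (decompInToH (κ.layerSubgroup n) w) (AddMonoidHom.id M) (fun _ _ ↦ rfl) (conjH1 (κ.layerSubgroup n) M Q.out z') - τ' w Q) = 0) ∧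
        (∀ w : HeightOneSpectrum (𝓞 K), w ∉ T → (((p : ℕ) : 𝓞 K) ∉ w.asIdeal ∨ w = vbar) →
          ∀ σ : absoluteGaloisGroup K, conjH1 (κ.layerSubgroup n) M σ z' ∈ unramifiedKer (κ.layerSubgroup n) M w)) :
    ∀ (T : Finset (HeightOneSpectrum (𝓞 K))), (∀ w ∈ T, ((p : ℕ) : 𝓞 K) ∉ w.asIdeal ∨ w = vbar) →
      ∀ τ : (w : HeightOneSpectrum (𝓞 K)) →
        DoubleCoset.Quotient (decomp (K := K) w : Set (absoluteGaloisGroup K)) (κ.kerSubgroup : Set (absoluteGaloisGroup K)) →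
          subgroupH1 (decompIn κ.kerSubgroup w) M,
      ∃ z : subgroupH1 κ.kerSubgroup M,
        (∀ w ∈ T, ∀ q : DoubleCoset.Quotient (decomp (K := K) w : Set (absoluteGaloisGroup K)) (κ.kerSubgroup : Set (absoluteGaloisGroup K)),
          resOfLe M (inertiaIn_le_decompIn κ.kerSubgroup w)
            (resH1Hom (decompInToH κ.kerSubgroup w) (AddMonoidHom.id M) (fun _ _ ↦ rfl) (conjH1 κ.kerSubgroup M q.out z) - τ w q) = 0) ∧
        (∀ w : HeightOneSpectrum (𝓞 K), w ∉ T → (((p : ℕ) : 𝓞 K) ∉ w.asIdeal ∨ w = vbar) →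
          ∀ σ : absoluteGaloisGroup K, conjH1 κ.kerSubgroup M σ z ∈ unramifiedKer κ.kerSubgroup M w) := by
  intro T hT τ
  -- (2a) stabilisation of the index sets and finiteness, from «no relevant place splits completely»
  have hstable : ∀ w : HeightOneSpectrum (𝓞 K), (((p : ℕ) : 𝓞 K) ∉ w.asIdeal ∨ w = vbar) → ∃ m : ℕ, ∀ n : ℕ, m ≤ n →
      ∀ σ σ' : absoluteGaloisGroup K,
        DoubleCoset.mk (decomp (K := K) w) (κ.layerSubgroup n) σ = DoubleCoset.mk (decomp (K := K) w) (κ.layerSubgroup n) σ' ↔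
          DoubleCoset.mk (decomp (K := K) w) κ.kerSubgroup σ = DoubleCoset.mk (decomp (K := K) w) κ.kerSubgroup σ' := by
    intro w hw
    obtain ⟨τ₀, hτ₀, hτ₀K⟩ := SetLike.not_le_iff_exists.mp (hD w hw)
    have hne : κ τ₀ ≠ 1 := fun h ↦ hτ₀K (ZpExtension.mem_kerSubgroup.2 h)
    obtain ⟨τ₁, hτ₁, hne₁, hmin⟩ := LineDoubleCoset.exists_mem_minimal_valuation κ (decomp (K := K) w) hτ₀ hne
    exact ⟨_, fun n hn σ σ' ↦ LineDoubleCoset.doubleCoset_mk_layerSubgroup_eq_iff_mk_kerSubgroup_eq κ (decomp (K := K) w)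
      (Coinv.isClosed_decomp w) hτ₁ hne₁ hmin hn σ σ'⟩
  choose mStab hmStab using hstable
  have hfinQ : ∀ w : HeightOneSpectrum (𝓞 K), (((p : ℕ) : 𝓞 K) ∉ w.asIdeal ∨ w = vbar) →
      Finite (DoubleCoset.Quotient (decomp (K := K) w : Set (absoluteGaloisGroup K)) (κ.kerSubgroup : Set (absoluteGaloisGroup K))) :=
    fun w hw ↦ LineDoubleCoset.finite_doubleCosetQuotient_decomp_of_not_le' κ (hD w hw)
  -- (1) every target is born at a finite layer
  have hlift : ∀ (w : HeightOneSpectrum (𝓞 K))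
      (q : DoubleCoset.Quotient (decomp (K := K) w : Set (absoluteGaloisGroup K)) (κ.kerSubgroup : Set (absoluteGaloisGroup K))),
      ∃ m : ℕ, ∀ n : ℕ, m ≤ n → ∃ x' : subgroupH1 (decompIn (κ.layerSubgroup n) w) M,
        resOfLe M (decompIn_kerSubgroup_le_layerSubgroup κ w n) x' = τ w q := fun w q ↦
    exists_forall_le_exists_resOfLe_decompIn_layerSubgroup_eq κ hstab (τ w q)
  choose mOf hmOf using hlift
  -- (2b) a common layer `N`
  have hB : ∀ (w : HeightOneSpectrum (𝓞 K)) (hw : ((p : ℕ) : 𝓞 K) ∉ w.asIdeal ∨ w = vbar), ∃ B : ℕ, mStab w hw ≤ B ∧ ∀ q, mOf w q ≤ B := by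
    intro w hw
    haveI := hfinQ w hw
    obtain ⟨B₁, hB₁⟩ := Finite.exists_le (mOf w)
    exact ⟨max (mStab w hw) B₁, le_max_left _ _, fun q ↦ (hB₁ q).trans (le_max_right _ _)⟩
  choose Bof hBof using hB
  set B' : HeightOneSpectrum (𝓞 K) → ℕ := fun w ↦ if h : (((p : ℕ) : 𝓞 K) ∉ w.asIdeal ∨ w = vbar) then Bof w h else 0 with hB'
  set N : ℕ := max n₁ (T.sup B') with hNdef
  have hN₁ : n₁ ≤ N := le_max_left _ _
  have hNB : ∀ (w : HeightOneSpectrum (𝓞 K)) (hwT : w ∈ T), Bof w (hT w hwT) ≤ N := by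
    intro w hwT
    have h1 : B' w ≤ T.sup B' := Finset.le_sup hwT
    have h2 : B' w = Bof w (hT w hwT) := dif_pos (hT w hwT)
    rw [h2] at h1
    exact h1.trans (le_max_right _ _)
  have hNstab : ∀ w (hwT : w ∈ T) (σ σ' : absoluteGaloisGroup K),
      DoubleCoset.mk (decomp (K := K) w) (κ.layerSubgroup N) σ = DoubleCoset.mk (decomp (K := K) w) (κ.layerSubgroup N) σ' ↔
        DoubleCoset.mk (decomp (K := K) w) κ.kerSubgroup σ = DoubleCoset.mk (decomp (K := K) w) κ.kerSubgroup σ' :=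
    fun w hwT σ σ' ↦ hmStab w (hT w hwT) N (((hBof w (hT w hwT)).1).trans (hNB w hwT)) σ σ'
  -- the lifted targets at layer `N`
  have hx : ∀ (w : HeightOneSpectrum (𝓞 K)) (hwT : w ∈ T)
      (q : DoubleCoset.Quotient (decomp (K := K) w : Set (absoluteGaloisGroup K)) (κ.kerSubgroup : Set (absoluteGaloisGroup K))),
      ∃ x' : subgroupH1 (decompIn (κ.layerSubgroup N) w) M, resOfLe M (decompIn_kerSubgroup_le_layerSubgroup κ w N) x' = τ w q :=
    fun w hwT q ↦ hmOf w q N (((hBof w (hT w hwT)).2 q).trans (hNB w hwT))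
  choose xOf hxOf using hx
  -- (3) the `K_N`-representatives: `Q.out = d · (q.out) · g`
  have hdg : ∀ (w : HeightOneSpectrum (𝓞 K))
      (Q : DoubleCoset.Quotient (decomp (K := K) w : Set (absoluteGaloisGroup K)) (κ.layerSubgroup N : Set (absoluteGaloisGroup K))),
      ∃ d : decomp (K := K) w, ∃ g : absoluteGaloisGroup K, g ∈ κ.kerSubgroup ∧
        Q.out = (d : absoluteGaloisGroup K) * (DoubleCoset.mk (decomp (K := K) w) κ.kerSubgroup Q.out).out * g := by
    intro w Q
    obtain ⟨d, hd, g, hg, he⟩ := (DoubleCoset.eq (decomp (K := K) w) κ.kerSubgroup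
      (DoubleCoset.mk (decomp (K := K) w) κ.kerSubgroup Q.out).out Q.out).1 (by rw [DoubleCoset.out_eq'])
    exact ⟨⟨d, hd⟩, g, hg, he⟩
  choose dOf gOf hgOf hdgOf using hdg
  haveI hNn : ∀ w : HeightOneSpectrum (𝓞 K), (decompIn (κ.layerSubgroup N) w).Normal := fun w ↦ Rank1Residual.SelmerDual.decompIn_normal _ w
  let τ' : (w : HeightOneSpectrum (𝓞 K)) →
      DoubleCoset.Quotient (decomp (K := K) w : Set (absoluteGaloisGroup K)) (κ.layerSubgroup N : Set (absoluteGaloisGroup K)) →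
        subgroupH1 (decompIn (κ.layerSubgroup N) w) M :=
    fun w Q ↦ if hwT : w ∈ T then
      conjH1 (decompIn (κ.layerSubgroup N) w) M (dOf w Q) (xOf w hwT (DoubleCoset.mk (decomp (K := K) w) κ.kerSubgroup Q.out)) else 0
  -- (LS_N)
  obtain ⟨z', hz'T, hz'0⟩ := hLSn N hN₁ T hT τ'
  refine ⟨resOfLe M (κ.kerSubgroup_le_layerSubgroup N) z', fun w hwT q ↦ ?_, fun w hwT hw σ ↦ ?_⟩
  · -- (4) matching over `K_∞` at `q.out` from the matching over `K_N` at `Q.out`, `Q` the layer class of `q.out`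
    have hw := hT w hwT
    set Q : DoubleCoset.Quotient (decomp (K := K) w : Set (absoluteGaloisGroup K)) (κ.layerSubgroup N : Set (absoluteGaloisGroup K)) :=
      DoubleCoset.mk (decomp (K := K) w) (κ.layerSubgroup N) q.out with hQdef
    have e1 : DoubleCoset.mk (decomp (K := K) w) κ.kerSubgroup Q.out = q := by
      have h1 : DoubleCoset.mk (decomp (K := K) w) (κ.layerSubgroup N) Q.out = DoubleCoset.mk (decomp (K := K) w) (κ.layerSubgroup N) q.out := by
        rw [DoubleCoset.out_eq']
      rw [(hNstab w hwT _ _).1 h1, DoubleCoset.out_eq']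
    -- `Q.out = d ρ g`, `ρ = q.out`
    have hg : gOf w Q ∈ κ.kerSubgroup := hgOf w Q
    have hout : Q.out = (dOf w Q : absoluteGaloisGroup K) * q.out * gOf w Q := by
      have h := hdgOf w Q
      rw [e1] at h
      exact h
    have hτ' : τ' w Q = conjH1 (decompIn (κ.layerSubgroup N) w) M (dOf w Q) (xOf w hwT q) := by
      show (if hwT : w ∈ T then conjH1 (decompIn (κ.layerSubgroup N) w) M (dOf w Q)
        (xOf w hwT (DoubleCoset.mk (decomp (K := K) w) κ.kerSubgroup Q.out)) else 0) = _
      rw [dif_pos hwT, e1]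
    have hmatch := hz'T w hwT Q
    rw [hτ', map_sub, sub_eq_zero] at hmatch
    -- `conj_{q.out} z' = conj_{d⁻¹} (conj_{Q.out} z')`
    have hqout : q.out = (((dOf w Q)⁻¹ : decomp (K := K) w) : absoluteGaloisGroup K) * Q.out * (gOf w Q)⁻¹ := by
      rw [hout, Subgroup.coe_inv]
      group
    have hconjq : conjH1 (κ.layerSubgroup N) M q.out z' =
        conjH1 (κ.layerSubgroup N) M (((dOf w Q)⁻¹ : decomp (K := K) w) : absoluteGaloisGroup K) (conjH1 (κ.layerSubgroup N) M Q.out z') := by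
      rw [hqout, Literature.NumberTheory.EllipticCurves.conjH1_mul_holds (κ.layerSubgroup N) M, AddMonoidHom.comp_apply,
        Literature.NumberTheory.EllipticCurves.conjH1_mul_holds (κ.layerSubgroup N) M, AddMonoidHom.comp_apply,
        Literature.NumberTheory.EllipticCurves.conjH1_of_mem_holds (κ.layerSubgroup N) M
          (κ.kerSubgroup_le_layerSubgroup N (κ.kerSubgroup.inv_mem hg)), AddMonoidHom.id_apply]
    -- localise at `D_w`
    have hDconj : ∀ y : subgroupH1 (κ.layerSubgroup N) M,
        resH1Hom (decompInToH (κ.layerSubgroup N) w) (AddMonoidHom.id M) (fun _ _ ↦ rfl)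
            (conjH1 (κ.layerSubgroup N) M (((dOf w Q)⁻¹ : decomp (K := K) w) : absoluteGaloisGroup K) y) =
          conjH1 (decompIn (κ.layerSubgroup N) w) M (dOf w Q)⁻¹
            (resH1Hom (decompInToH (κ.layerSubgroup N) w) (AddMonoidHom.id M) (fun _ _ ↦ rfl) y) := fun y ↦
      congrArg (fun f ↦ f y) (resH1Hom_decompInToH_comp_conjH1 (κ.layerSubgroup N) M w (dOf w Q)⁻¹)
    -- the defect `u` at layer `N`, vanishing on inertia
    obtain ⟨u, hu0, hu⟩ : ∃ u : subgroupH1 (decompIn (κ.layerSubgroup N) w) M,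
        resOfLe M (inertiaIn_le_decompIn (κ.layerSubgroup N) w) u = 0 ∧
        resH1Hom (decompInToH (κ.layerSubgroup N) w) (AddMonoidHom.id M) (fun _ _ ↦ rfl) (conjH1 (κ.layerSubgroup N) M Q.out z') =
          conjH1 (decompIn (κ.layerSubgroup N) w) M (dOf w Q) (xOf w hwT q) + u := by
      refine ⟨resH1Hom (decompInToH (κ.layerSubgroup N) w) (AddMonoidHom.id M) (fun _ _ ↦ rfl) (conjH1 (κ.layerSubgroup N) M Q.out z') -
        conjH1 (decompIn (κ.layerSubgroup N) w) M (dOf w Q) (xOf w hwT q), ?_, by abel⟩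
      rw [map_sub, sub_eq_zero]
      exact hmatch
    have hloc : resH1Hom (decompInToH (κ.layerSubgroup N) w) (AddMonoidHom.id M) (fun _ _ ↦ rfl) (conjH1 (κ.layerSubgroup N) M q.out z') =
        xOf w hwT q + conjH1 (decompIn (κ.layerSubgroup N) w) M (dOf w Q)⁻¹ u := by
      rw [hconjq, hDconj, hu, map_add, ← AddMonoidHom.comp_apply (conjH1 _ M (dOf w Q)⁻¹) (conjH1 _ M (dOf w Q)),
        ← Literature.NumberTheory.EllipticCurves.conjH1_mul_holds (decompIn (κ.layerSubgroup N) w) M, inv_mul_cancel,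
        Literature.NumberTheory.EllipticCurves.conjH1_one_holds (decompIn (κ.layerSubgroup N) w) M, AddMonoidHom.id_apply]
    -- restrict from `Γ_N` to `ker κ`
    have hres1 : conjH1 κ.kerSubgroup M q.out (resOfLe M (κ.kerSubgroup_le_layerSubgroup N) z') =
        resOfLe M (κ.kerSubgroup_le_layerSubgroup N) (conjH1 (κ.layerSubgroup N) M q.out z') :=
      (congrArg (fun f ↦ f z') (resOfLe_comp_conjH1_holds (M := M) (κ.kerSubgroup_le_layerSubgroup N) q.out)).symm
    have hres2 : ∀ y : subgroupH1 (κ.layerSubgroup N) M,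
        resH1Hom (decompInToH κ.kerSubgroup w) (AddMonoidHom.id M) (fun _ _ ↦ rfl) (resOfLe M (κ.kerSubgroup_le_layerSubgroup N) y) =
          resOfLe M (decompIn_kerSubgroup_le_layerSubgroup κ w N)
            (resH1Hom (decompInToH (κ.layerSubgroup N) w) (AddMonoidHom.id M) (fun _ _ ↦ rfl) y) := fun y ↦
      congrArg (fun f ↦ f y) (resH1Hom_decompInToH_comp_resOfLe M w (κ.kerSubgroup_le_layerSubgroup N))
    have hrr : ∀ (A B C : Subgroup (decomp (K := K) w)) (h1 : A ≤ B) (h2 : B ≤ C) (y : subgroupH1 C M),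
        resOfLe M h1 (resOfLe M h2 y) = resOfLe M (h1.trans h2) y := fun A B C h1 h2 y ↦
      congrArg (fun f ↦ f y) (resOfLe_comp_holds (M := M) h1 h2)
    have hkey : resH1Hom (decompInToH κ.kerSubgroup w) (AddMonoidHom.id M) (fun _ _ ↦ rfl)
          (conjH1 κ.kerSubgroup M q.out (resOfLe M (κ.kerSubgroup_le_layerSubgroup N) z')) - τ w q =
        resOfLe M (decompIn_kerSubgroup_le_layerSubgroup κ w N) (conjH1 (decompIn (κ.layerSubgroup N) w) M (dOf w Q)⁻¹ u) := by
      rw [hres1, hres2, hloc, map_add, hxOf w hwT q]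
      abel
    rw [hkey, hrr _ _ _ (inertiaIn_le_decompIn κ.kerSubgroup w) (decompIn_kerSubgroup_le_layerSubgroup κ w N),
      ← hrr _ _ _ (inertiaIn_kerSubgroup_le_layerSubgroup κ w N) (inertiaIn_le_decompIn (κ.layerSubgroup N) w),
      resOfLe_conjH1_decompIn_eq_zero (dOf w Q)⁻¹ hu0, map_zero]
  · -- unramified elsewhere: restriction from `Γ_N` to `ker κ` preserves it
    have h1 := hz'0 w hwT hw σ
    rw [GreenbergVatsal2000.unramifiedKer, AddMonoidHom.mem_ker] at h1 ⊢
    have hcr : conjH1 κ.kerSubgroup M σ (resOfLe M (κ.kerSubgroup_le_layerSubgroup N) z') =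
        resOfLe M (κ.kerSubgroup_le_layerSubgroup N) (conjH1 (κ.layerSubgroup N) M σ z') :=
      (congrArg (fun f ↦ f z') (resOfLe_comp_conjH1_holds (M := M) (κ.kerSubgroup_le_layerSubgroup N) σ)).symm
    have hci : resH1Hom (inertiaInToH κ.kerSubgroup w) (AddMonoidHom.id M) (fun _ _ ↦ rfl)
          (resOfLe M (κ.kerSubgroup_le_layerSubgroup N) (conjH1 (κ.layerSubgroup N) M σ z')) =
        resOfLe M (inertiaIn_kerSubgroup_le_layerSubgroup κ w N)
          (resH1Hom (inertiaInToH (κ.layerSubgroup N) w) (AddMonoidHom.id M) (fun _ _ ↦ rfl) (conjH1 (κ.layerSubgroup N) M σ z')) :=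
      congrArg (fun f ↦ f (conjH1 (κ.layerSubgroup N) M σ z'))
        (resH1Hom_inertiaInToH_comp_resOfLe M w (κ.kerSubgroup_le_layerSubgroup N) (inertiaIn_kerSubgroup_le_layerSubgroup κ w N))
    rw [hcr, hci, h1, map_zero]

end Limit

end Summit.BirchSwinnertonDyer.BirchSwinnertonDyer.Theorems.PrintCf2.UpperBaseLift

end
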